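import Mathlib
import Literature.Analysis.UnboundedOperators.HeatExtensionHarnack
import Summits.NavierStokesRegularity.NavierStokesRegularity.Theorems.LevelSetModerationHighSpeedPressureWorkFastSetSource
import Summits.NavierStokesRegularity.NavierStokesRegularity.Theorems.LevelSetModerationHighSpeedPressureWorkFastSetElementary

/-!
# Route LevelSetModeration — `HighSpeedPressureWork`: the Duhamel term at a fast point is log-small

Support file for item stmt-NavierStokesRegularity-18149 (`HighSpeedPressureWork`), stub
`stub_earlyBookkeeping` (margin zero). A by-product of the log-free deficit analysis
(`…FastSetDeficit.lean`): at a point that is fast in a unit direction `e` at time `t`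
(`⟪e, u(t,x)⟫ > 1/2`, unit normalisation), the Duhamel term from the early time `s₀ = t²` is
smaller than its generic size `√t` by a logarithm,

  `‖B_{t²}(u,u)(t)(x)‖ ≤ c √t / √(log(1/t))`   (`levelSetModeration_fastSet_duhamel_small`).

Same mechanism as the deficit lemma (sharp Harnack localisation of the sources inside the radius
`√((t−σ)ℓ')`, far-field slice bound outside, `ℓ' = log(1/(2δ'))` with `δ' = max δ t²`), finished
differently: `κ'√ℓ' ≤ 2`, `t√ℓ' ≤ √2√t` and `ℓ' ≥ ¼ log(1/t)` (the deficit is `≲ √t` by fastness).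
Consequence (next file): the LOG-SUPPRESSED OVERSHOOT bound `sup|u(t)| ≤ B₀ + C B₀√(B₀²t/ν)/√log(ν/(4B₀²t))`.
-/

noncomputable section

-- single-conjunct summit: `Summit.<Summit>.<Problem>` repeats the name by the D-0017 layout
set_option linter.dupNamespace false

namespace Summit.NavierStokesRegularity.NavierStokesRegularity.Theorems

open MeasureTheory Set Filter Topology Function Metric
open scoped ENNReal RealInnerProductSpace
open Literature.Analysis.FluidPDE
open Literature.Analysis.UnboundedOperators (heatExtension heatKernel heatExtension_apply
  norm_heatExtension_le_of_bound heatExtension_le_harnack_shift contDiff_heatExtension_holds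
  memLp_top_of_continuous_of_bound)
/-- **The Duhamel term at a fast point is log-small.** Absolute `c ≥ 0`, `ε > 0` such that for
every classical solution (`ν = 1`) on `ℝ³ × (0, b)` with `‖u‖ ≤ 1` on `(0, T] × ℝ³` (`T < b`),
`‖u(t)‖_{L²} ≤ K < ∞` there, every `t ∈ (0,T)` with `t ≤ ε`, constants `C ≥ 0` with `C√t ≤ 1` and
`B_s ∈ [1/2, 1]` with `B_s − 1/2 ≤ C t` and `‖u(t²,·)‖ ≤ B_s`, every point `x` and unit vector `e`
with `⟪e, u(t,x)⟫ > 1/2`: `‖B_{t²}(u,u)(t)(x)‖ ≤ c √t/√(log(1/t))`. [folklore] -/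
theorem levelSetModeration_fastSet_duhamel_small :
    ∃ c ε : ℝ, 0 ≤ c ∧ 0 < ε ∧ ∀ {b T : ℝ} {u : ℝ → EuclideanSpace ℝ (Fin 3) → EuclideanSpace ℝ (Fin 3)} {p : ℝ → EuclideanSpace ℝ (Fin 3) → ℝ}, Literature.Analysis.FluidPDE.IsClassicalNSSolutionOn (Set.Ioo 0 b) 1 0 u p → 0 < T → T < b → (∀ t ∈ Set.Ioc 0 T, ∀ x, ‖u t x‖ ≤ 1) → ∀ {K : ENNReal}, K ≠ ⊤ → (∀ t ∈ Set.Ioc 0 T, MeasureTheory.eLpNorm (u t) 2 MeasureTheory.volume ≤ K) → ∀ t ∈ Set.Ioo 0 T, t ≤ ε → ∀ (Cov Bs : ℝ), 0 ≤ Cov → Cov * Real.sqrt t ≤ 1 → 1 / 2 ≤ Bs → Bs ≤ 1 → Bs - 1 / 2 ≤ Cov * t → (∀ y, ‖u (t ^ 2) y‖ ≤ Bs) → ∀ (x e : EuclideanSpace ℝ (Fin 3)), ‖e‖ = 1 → 1 / 2 < inner ℝ e (u t x) → ‖Literature.Analysis.FluidPDE.oseenDuhamel 1 (t ^ 2) u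 u t x‖ ≤ c * Real.sqrt t / Real.sqrt (Real.log (1 / t)) := by
  obtain ⟨CD, hCD, hDuh⟩ := exists_norm_oseenDuhamel_le_mul (E := EuclideanSpace ℝ (Fin 3))
  obtain ⟨CS, CF, hCS, hCF, hSrc⟩ := levelSetModeration_oseenSlice_source_le
  -- `c₄ = 2 + 2 C_D` bounds `δ'/√t`; `ℓ' ≥ ¼ log(1/t)` once `t ≤ (2c₄)^{-4}`
  set c₄ : ℝ := 2 + 2 * CD with hc₄
  set c : ℝ := 2 * (48 * CS + Real.sqrt 2 * (8 * CS * CD) + 8 * CF) with hc_def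
  set ε : ℝ := min (1 / 64) (min (1 / (256 * CD ^ 2)) (1 / (2 * c₄) ^ 4)) with hε_def
  have hc₄1 : 1 ≤ c₄ := by rw [hc₄]; linarith [hCD.le]
  have hε0 : 0 < ε := by rw [hε_def]; positivity
  refine ⟨c, ε, by positivity, hε0, ?_⟩
  intro b T u p hcl' hT hTb hbd' K hK hL2' t ht htε Cov Bs hCov hCovs hBs12 hBs1 hBsC hus₀' x e hen hex
  have ht0 : 0 < t := ht.1
  have ht64 : t ≤ 1 / 64 := htε.trans (min_le_left _ _)
  have htCD' : t ≤ 1 / (256 * CD ^ 2) := htε.trans ((min_le_right _ _).trans (min_le_left _ _))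
  have htc₄ : t ≤ 1 / (2 * c₄) ^ 4 := htε.trans ((min_le_right _ _).trans (min_le_right _ _))
  have hsqt8 : Real.sqrt t ≤ 1 / 8 := by
    rw [show (1 : ℝ) / 8 = Real.sqrt ((1 / 8) ^ 2) by rw [Real.sqrt_sq (by norm_num)]]
    exact Real.sqrt_le_sqrt (by norm_num at ht64 ⊢; linarith)
  have hCovt : Cov * t ≤ 1 / 8 := by
    calc Cov * t = Cov * Real.sqrt t * Real.sqrt t := by rw [mul_assoc, Real.mul_self_sqrt ht0.le]
      _ ≤ 1 * (1 / 8) := mul_le_mul hCovs hsqt8 (Real.sqrt_nonneg _) (by norm_num)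
      _ = 1 / 8 := one_mul _
  have htε' : t ≤ min (1 / 2) (1 / (256 * CD ^ 2)) := le_min (by linarith) htCD'
  -- the window
  have ht12 : t ≤ 1 / 2 := htε'.trans (min_le_left _ _)
  have ht1 : t ≤ 1 := by linarith
  have htCD : 2 * CD * Real.sqrt t ≤ 1 / 8 := by
    have h1 : t ≤ 1 / (256 * CD ^ 2) := htε'.trans (min_le_right _ _)
    have h2 : Real.sqrt t ≤ Real.sqrt (1 / (256 * CD ^ 2)) := Real.sqrt_le_sqrt h1
    have h3 : Real.sqrt (1 / (256 * CD ^ 2)) = 1 / (16 * CD) := by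
      rw [show (1 : ℝ) / (256 * CD ^ 2) = (1 / (16 * CD)) ^ 2 by field_simp; norm_num,
        Real.sqrt_sq (by positivity)]
    rw [h3] at h2
    calc 2 * CD * Real.sqrt t ≤ 2 * CD * (1 / (16 * CD)) := mul_le_mul_of_nonneg_left h2 (by positivity)
      _ = 1 / 8 := by field_simp; norm_num
  -- times: `s₀ = t²`
  set s₀ : ℝ := t ^ 2 with hs₀_def
  have hs₀ : 0 < s₀ := by rw [hs₀_def]; exact pow_pos ht0 2
  have hs₀t : s₀ < t := by rw [hs₀_def, sq]; exact mul_lt_of_lt_one_left ht0 (by linarith)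
  have hs₀T : s₀ < T := hs₀t.trans ht.2
  have hts : t / 2 ≤ t - s₀ := by
    have : t ^ 2 ≤ t * (1 / 2) := by rw [sq]; exact mul_le_mul_of_nonneg_left ht12 ht0.le
    rw [hs₀_def]; linarith
  have hts0 : 0 < t - s₀ := sub_pos.2 hs₀t
  have hsqt : 0 < Real.sqrt t := Real.sqrt_pos.2 ht0
  have hBs0 : 0 < Bs := by linarith
  have hus₀ : ∀ y, ‖u s₀ y‖ ≤ Bs := hus₀'
  -- (1) the mild formula from `s₀`
  have hmild : ∀ {σ : ℝ}, s₀ < σ → σ < T → ∀ y,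
      u σ y = heatExtension (u s₀) (σ - s₀) y - oseenDuhamel 1 s₀ u u σ y := fun hσ hσT y =>
    mild_of_bounded_of_eLpNorm_two_le_of_lt hcl' hT hTb hbd' hK hL2' hs₀ hσ hσT y
  have hbd : ∀ τ, s₀ < τ → τ ≤ t → ∀ y, ‖u τ y‖ ≤ 1 := fun τ h1 h2 y =>
    hbd' τ ⟨hs₀.trans h1, h2.trans ht.2.le⟩ y
  -- (3) the Duhamel sup bound from `s₀`
  have hduh : ∀ {σ : ℝ}, s₀ < σ → σ ≤ t → ∀ y, ‖oseenDuhamel 1 s₀ u u σ y‖ ≤ 2 * CD * Real.sqrt t := by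
    intro σ hσ hσt y
    have hbdI : ∀ τ ∈ Ioo s₀ σ, ∀ y, ‖u τ y‖ ≤ 1 := fun τ hτ y =>
      hbd τ hτ.1 (hτ.2.le.trans hσt) y
    have h := hDuh one_pos hσ zero_le_one zero_le_one hbdI hbdI y
    rw [Real.one_rpow] at h
    have h2 : Real.sqrt (σ - s₀) ≤ Real.sqrt t := Real.sqrt_le_sqrt (by linarith [hs₀.le])
    calc ‖oseenDuhamel 1 s₀ u u σ y‖ ≤ CD * 1 * 1 * 1 * (2 * Real.sqrt (σ - s₀)) := h
      _ ≤ CD * 1 * 1 * 1 * (2 * Real.sqrt t) := by gcongr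
      _ = 2 * CD * Real.sqrt t := by ring
  -- (5) the datum `g = Bs − ⟪e, u(s₀)⟫ ∈ [0, 2Bs]` and the deficit
  set g : EuclideanSpace ℝ (Fin 3) → ℝ := fun y => Bs - ⟪e, u s₀ y⟫ with hg
  have hcont_s₀ : Continuous (u s₀) := (hcl'.contDiff_velocity ⟨hs₀, hs₀T.trans hTb⟩).continuous
  have hgc : Continuous g := continuous_const.sub (continuous_const.inner hcont_s₀)
  have hinner_le : ∀ y, |⟪e, u s₀ y⟫| ≤ Bs := fun y =>
    (abs_real_inner_le_norm e (u s₀ y)).trans (by rw [hen, one_mul]; exact hus₀ y)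
  have hg0 : ∀ y, 0 ≤ g y := fun y => by
    have := (le_abs_self _).trans (hinner_le y)
    simp only [hg]; linarith
  have hgM : ∀ y, g y ≤ 2 * Bs := fun y => by
    have h2 : -Bs ≤ ⟪e, u s₀ y⟫ := (neg_le_neg (hinner_le y)).trans (neg_abs_le _)
    simp only [hg]; linarith
  have hgb : ∀ y, ‖g y‖ ≤ 2 * Bs := fun y => by
    rw [Real.norm_of_nonneg (hg0 y)]; exact hgM y
  set δ : ℝ := heatExtension g (t - s₀) x with hδ
  have hδ0 : 0 ≤ δ := fastSet_heatExtension_nonneg hg0 hts0 x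
  have hδM : δ ≤ 2 * Bs := by
    have := norm_heatExtension_le_of_bound hgb hts0 x
    rw [Real.norm_of_nonneg hδ0] at this
    exact this
  -- (6) the caloric part at time `t` and the fastness inequality `δ ≤ C t + ‖w(x)‖`
  set Ht : EuclideanSpace ℝ (Fin 3) → EuclideanSpace ℝ (Fin 3) := heatExtension (u s₀) (t - s₀) with hHt
  set wt : EuclideanSpace ℝ (Fin 3) → EuclideanSpace ℝ (Fin 3) := fun y => oseenDuhamel 1 s₀ u u t y
    with hwt
  have hgHt : heatExtension g (t - s₀) = fun z => Bs - ⟪e, Ht z⟫ := by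
    funext z; rw [hHt]; exact heatExtension_const_sub_inner hcont_s₀ hus₀ Bs e hts0 z
  have hwt_le : ‖wt x‖ ≤ 2 * CD * Real.sqrt t := hduh hs₀t le_rfl x
  have hδle : δ ≤ Cov * t + ‖wt x‖ := by
    have hHx : Ht x = u t x + wt x := by
      rw [hHt, hwt]; dsimp only; rw [hmild hs₀t ht.2 x]; abel
    have h1 : δ = Bs - ⟪e, u t x⟫ - ⟪e, wt x⟫ := by
      rw [hδ, hgHt]; simp only [hHx, inner_add_right]; ring
    have h2 : -⟪e, wt x⟫ ≤ ‖wt x‖ := by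
      have := abs_real_inner_le_norm e (wt x)
      rw [hen, one_mul] at this
      linarith [neg_abs_le ⟪e, wt x⟫]
    rw [h1]; linarith
  have hδ4 : δ ≤ 1 / 4 := by linarith
  -- (7') the majorant `δ' = max δ t²` and the localised Duhamel bound
  set δ' : ℝ := max δ s₀ with hδ'_def
  have hδ'pos : 0 < δ' := hs₀.trans_le (le_max_right _ _)
  have hδδ' : δ ≤ δ' := le_max_left _ _
  have hs₀δ' : s₀ ≤ δ' := le_max_right _ _
  have hδ'4 : δ' ≤ 1 / 4 := max_le hδ4 (by
    rw [hs₀_def]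
    calc t ^ 2 = t * t := sq t
      _ ≤ (1 / 2) * (1 / 2) := mul_le_mul ht12 ht12 ht0.le (by norm_num)
      _ = 1 / 4 := by norm_num)
  -- (7) THE DEFICIT BOUND: either `δ' ≤ t²` or `δ' √(log(1/(2δ'))) ≤ a √t`
  set ℓ : ℝ := Real.log (1 / (2 * δ')) with hℓ
  have hℓpos : 0 < ℓ := by
    rw [hℓ]; refine Real.log_pos ?_
    rw [lt_div_iff₀ (by positivity)]; linarith
  have hsqℓ : 0 < Real.sqrt ℓ := Real.sqrt_pos.2 hℓpos
  have hℓle : ℓ ≤ 2 * Real.log (1 / t) := by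
    have h1 : 1 / (2 * δ') ≤ (1 / t) ^ 2 := by
      rw [div_le_iff₀ (by positivity), one_div, inv_pow, ← hs₀_def]
      have : s₀⁻¹ * (2 * s₀) ≤ s₀⁻¹ * (2 * δ') := by gcongr
      calc (1 : ℝ) ≤ 2 := by norm_num
        _ = s₀⁻¹ * (2 * s₀) := by field_simp
        _ ≤ _ := this
    calc ℓ ≤ Real.log ((1 / t) ^ 2) := Real.log_le_log (by positivity) h1
      _ = 2 * Real.log (1 / t) := by rw [Real.log_pow]; norm_num
  -- the Harnack factor `e^{ℓ/4} = (1/(2δ'))^{1/4}` and `κ = (2δ')^{3/8}`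
  set κ : ℝ := (2 * δ') ^ (3 / 8 : ℝ) with hκ
  have hκ0 : 0 ≤ κ := by rw [hκ]; positivity
  have hexpℓ : Real.exp (ℓ / 4) = (1 / (2 * δ')) ^ (1 / 4 : ℝ) := by
    rw [hℓ, Real.rpow_def_of_pos (by positivity)]; congr 1; ring
  have hκsq : 2 * (Real.exp (ℓ / 4) * δ') = κ ^ 2 := by
    have h2δ' : 0 < 2 * δ' := by positivity
    have hL : Real.exp (ℓ / 4) = ((2 * δ') ^ (1 / 4 : ℝ))⁻¹ := by
      rw [hexpℓ, one_div, Real.inv_rpow h2δ'.le]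
    have hR : κ ^ 2 = (2 * δ') ^ (3 / 4 : ℝ) := by
      rw [hκ, ← Real.rpow_natCast, ← Real.rpow_mul h2δ'.le]; norm_num
    have h34 : (2 * δ') ^ (3 / 4 : ℝ) = (2 * δ') * ((2 * δ') ^ (1 / 4 : ℝ))⁻¹ := by
      rw [← Real.rpow_neg h2δ'.le, show (3 / 4 : ℝ) = 1 + -(1 / 4) by norm_num, Real.rpow_add h2δ',
        Real.rpow_one]
    rw [hL, hR, h34]; ring
  -- the one-slice bound for `σ ∈ (s₀, t)`
  have hslice : ∀ σ ∈ Ioo s₀ t, ‖oseenSlice (1 * (t - σ)) (u σ) (u σ) x‖ ≤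
      2 * CS * (t - σ) ^ (-(1 / 2 : ℝ)) *
        (κ * ((t - s₀) / (σ - s₀)) ^ (3 / 4 : ℝ) + 2 * CD * Real.sqrt t) +
        4 * CF / (Real.sqrt (t - σ) * Real.sqrt ℓ) := by
    intro σ hσ
    have hσT : σ < T := hσ.2.trans ht.2
    have htσ : 0 < t - σ := sub_pos.2 hσ.2
    have hτ : 0 < 1 * (t - σ) := by rw [one_mul]; exact htσ
    have hθ : 0 < σ - s₀ := sub_pos.2 hσ.1
    set r : ℝ := Real.sqrt (t - σ) * Real.sqrt ℓ with hr
    have hr0 : 0 < r := by rw [hr]; exact mul_pos (Real.sqrt_pos.2 htσ) hsqℓ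
    have hr2 : r ^ 2 / (4 * (t - σ)) = ℓ / 4 := by
      rw [hr, mul_pow, Real.sq_sqrt htσ.le, Real.sq_sqrt hℓpos.le]
      field_simp
    -- Harnack inside the ball
    set Λ : ℝ := ((t - s₀) / (σ - s₀)) ^ ((3 : ℝ) / 2) * Real.exp (ℓ / 4) * δ' with hΛ
    have hΛ0 : 0 ≤ Λ := by rw [hΛ]; positivity
    have hHarn : ∀ y, ‖x - y‖ < r → heatExtension (fun z => Bs - ⟪e, u s₀ z⟫) (σ - s₀) y ≤ Λ := by
      intro y hy
      have h := heatExtension_le_harnack_shift hgc hg0 hgM hσ.1 hσ.2 x y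
      rw [finrank_euclideanSpace_fin] at h
      refine h.trans ?_
      rw [hΛ, ← hδ]
      have hexp : Real.exp (‖x - y‖ ^ 2 / (4 * (t - σ))) ≤ Real.exp (ℓ / 4) := by
        refine Real.exp_le_exp.2 ?_
        rw [← hr2]
        exact div_le_div_of_nonneg_right (pow_le_pow_left₀ (norm_nonneg _) hy.le 2) (by
          linarith [sub_pos.2 hσ.2])
      exact mul_le_mul (mul_le_mul_of_nonneg_left hexp (by positivity)) hδδ' hδ0 (by positivity)
    have hcontσ : Continuous (u σ) := (hcl'.contDiff_velocity ⟨hs₀.trans hσ.1, hσT.trans hTb⟩).continuous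
    have huσ : ∀ y, ‖u σ y‖ ≤ 1 := fun y => hbd σ hσ.1 hσ.2.le y
    have hvW : ∀ y, u σ y = heatExtension (u s₀) (σ - s₀) y - oseenDuhamel 1 s₀ u u σ y :=
      hmild hσ.1 hσT
    have hW : ∀ y, ‖oseenDuhamel 1 s₀ u u σ y‖ ≤ 2 * CD * Real.sqrt t := hduh hσ.1 hσ.2.le
    have h := hSrc hτ hθ hBs0 hBs1 (by positivity : (0 : ℝ) ≤ 2 * CD * Real.sqrt t) hΛ0 hr0
      hcont_s₀ hus₀ hen hcontσ huσ hvW hW hHarn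
    -- simplify the right-hand side
    have hsqrtΛ : Real.sqrt (2 * Bs * Λ) ≤ κ * ((t - s₀) / (σ - s₀)) ^ (3 / 4 : ℝ) := by
      have hq : 0 ≤ (t - s₀) / (σ - s₀) := by positivity
      have h32 : ((t - s₀) / (σ - s₀)) ^ ((3 : ℝ) / 2) = (((t - s₀) / (σ - s₀)) ^ (3 / 4 : ℝ)) ^ 2 := by
        rw [← Real.rpow_natCast, ← Real.rpow_mul hq]; norm_num
      have h1 : 2 * Bs * Λ ≤ (κ * ((t - s₀) / (σ - s₀)) ^ (3 / 4 : ℝ)) ^ 2 := by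
        calc 2 * Bs * Λ ≤ 2 * 1 * Λ := by gcongr
          _ = (κ * ((t - s₀) / (σ - s₀)) ^ (3 / 4 : ℝ)) ^ 2 := by
              rw [hΛ, h32, mul_pow, ← hκsq]; ring
      calc Real.sqrt (2 * Bs * Λ) ≤ Real.sqrt ((κ * ((t - s₀) / (σ - s₀)) ^ (3 / 4 : ℝ)) ^ 2) :=
            Real.sqrt_le_sqrt h1
        _ = κ * ((t - s₀) / (σ - s₀)) ^ (3 / 4 : ℝ) :=
            Real.sqrt_sq (mul_nonneg hκ0 (Real.rpow_nonneg hq _))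
    rw [one_mul] at h
    have hτ' : 0 ≤ 2 * CS * (t - σ) ^ (-(1 / 2 : ℝ)) :=
      mul_nonneg (by positivity) (Real.rpow_nonneg (sub_pos.2 hσ.2).le _)
    calc ‖oseenSlice (1 * (t - σ)) (u σ) (u σ) x‖
        ≤ 2 * CS * (t - σ) ^ (-(1 / 2 : ℝ)) * (Real.sqrt (2 * Bs * Λ) + 2 * CD * Real.sqrt t) +
            4 * CF / r := by rw [one_mul]; exact h
      _ ≤ 2 * CS * (t - σ) ^ (-(1 / 2 : ℝ)) *
            (κ * ((t - s₀) / (σ - s₀)) ^ (3 / 4 : ℝ) + 2 * CD * Real.sqrt t) + 4 * CF / r :=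
          add_le_add (mul_le_mul_of_nonneg_left (add_le_add hsqrtΛ le_rfl) hτ') le_rfl
  -- integrate over `(s₀, t)`
  obtain ⟨hbi, hbint⟩ := fastSet_integral_sourceBound_le (s₀ := s₀) (t := t) (κ := κ) (ℓ := ℓ)
    (CS := CS) (CD := CD) (CF := CF) hs₀.le hs₀t hκ0 hℓpos hCS.le hCD.le hCF.le
  have hwt_int : ‖wt x‖ ≤ 24 * CS * κ * Real.sqrt t + 8 * CS * CD * t + 8 * CF * Real.sqrt t / Real.sqrt ℓ := by
    have hrepr : wt x = ∫ σ in Ioo s₀ t, oseenSlice (1 * (t - σ)) (u σ) (u σ) x := by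
      rw [hwt]; dsimp only; rw [oseenDuhamel_apply]; rfl
    rw [hrepr]
    refine (norm_integral_le_of_norm_le hbi ?_).trans hbint
    exact (ae_restrict_iff' measurableSet_Ioo).2 (Eventually.of_forall hslice)
  -- `κ √ℓ ≤ 2`, `t √ℓ ≤ √2 √t`
  have hκℓ : κ * Real.sqrt ℓ ≤ 2 := by
    have := fastSet_rpow_mul_sqrt_log_le (y := 2 * δ') (by positivity)
    rwa [← hκ, ← hℓ] at this
  have htℓ : t * Real.sqrt ℓ ≤ Real.sqrt 2 * Real.sqrt t := fastSet_mul_sqrt_le ht.1 hℓle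

  -- (8') the lower bound `ℓ' ≥ ¼ log(1/t)` and the final estimate
  have hwt_le' : ‖wt x‖ ≤ 2 * CD * Real.sqrt t := hwt_le
  have hδ'le : 2 * δ' ≤ 2 * c₄ * Real.sqrt t := by
    have h1 : δ ≤ Cov * t + 2 * CD * Real.sqrt t := hδle.trans (add_le_add le_rfl hwt_le')
    have h2 : Cov * t ≤ Real.sqrt t := by
      calc Cov * t = Cov * Real.sqrt t * Real.sqrt t := by rw [mul_assoc, Real.mul_self_sqrt ht0.le]
        _ ≤ 1 * Real.sqrt t := mul_le_mul_of_nonneg_right hCovs (Real.sqrt_nonneg _)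
        _ = Real.sqrt t := one_mul _
    have h3 : s₀ ≤ Real.sqrt t := by
      rw [hs₀_def]
      calc t ^ 2 ≤ t := pow_le_of_le_one ht0.le ht1 two_ne_zero
        _ = Real.sqrt t * Real.sqrt t := (Real.mul_self_sqrt ht0.le).symm
        _ ≤ 1 * Real.sqrt t := mul_le_mul_of_nonneg_right (Real.sqrt_le_one.2 ht1) (Real.sqrt_nonneg _)
        _ = Real.sqrt t := one_mul _
    have hnn : 0 ≤ 2 * CD * Real.sqrt t := by positivity
    have h4 : δ' ≤ Real.sqrt t + 2 * CD * Real.sqrt t + Real.sqrt t :=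
      max_le (by linarith only [h1, h2, Real.sqrt_nonneg t]) (by linarith only [h3, hnn, Real.sqrt_nonneg t])
    calc 2 * δ' ≤ 2 * (Real.sqrt t + 2 * CD * Real.sqrt t + Real.sqrt t) :=
          mul_le_mul_of_nonneg_left h4 (by norm_num)
      _ = 2 * c₄ * Real.sqrt t := by rw [hc₄]; ring
  have hℓ'low : Real.log (1 / t) / 4 ≤ ℓ := by
    -- `ℓ = log(1/(2δ')) ≥ log(1/(2c₄√t)) = ½ log(1/t) − log(2c₄) ≥ ¼ log(1/t)` for `t ≤ (2c₄)^{-4}`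
    have h1 : Real.log (1 / (2 * c₄ * Real.sqrt t)) ≤ ℓ := by
      rw [hℓ]
      refine Real.log_le_log (by positivity) ?_
      exact div_le_div_of_nonneg_left (by norm_num) (by positivity) hδ'le
    have h2 : Real.log (1 / (2 * c₄ * Real.sqrt t)) = Real.log (1 / t) / 2 - Real.log (2 * c₄) := by
      rw [one_div, Real.log_inv, Real.log_mul (by positivity) hsqt.ne', Real.log_sqrt ht0.le, one_div,
        Real.log_inv]
      ring
    have h3 : Real.log (2 * c₄) ≤ Real.log (1 / t) / 4 := by
      have h4 : (2 * c₄) ^ 4 ≤ 1 / t := by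
        rw [le_div_iff₀ ht0]
        calc (2 * c₄) ^ 4 * t ≤ (2 * c₄) ^ 4 * (1 / (2 * c₄) ^ 4) :=
              mul_le_mul_of_nonneg_left htc₄ (by positivity)
          _ = 1 := by field_simp
      have h5 : Real.log ((2 * c₄) ^ 4) ≤ Real.log (1 / t) := Real.log_le_log (by positivity) h4
      rw [Real.log_pow] at h5
      push_cast at h5
      linarith only [h5]
    linarith only [h1, h2, h3]
  have hlogt : 0 < Real.log (1 / t) := Real.log_pos (by rw [lt_div_iff₀ ht0]; linarith only [ht1, ht12])
  have hsqlog : 0 < Real.sqrt (Real.log (1 / t)) := Real.sqrt_pos.2 hlogt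
  have hinvℓ : 1 / Real.sqrt ℓ ≤ 2 / Real.sqrt (Real.log (1 / t)) := by
    rw [div_le_div_iff₀ hsqℓ hsqlog, one_mul]
    have : Real.sqrt (Real.log (1 / t)) ≤ Real.sqrt (4 * ℓ) := Real.sqrt_le_sqrt (by linarith only [hℓ'low])
    rwa [Real.sqrt_mul (by norm_num), show Real.sqrt 4 = 2 by
      rw [show (4:ℝ) = 2 ^ 2 by norm_num, Real.sqrt_sq (by norm_num)]] at this
  -- `‖w‖ ≤ (48 C_S + 8√2 C_S C_D + 8 C_F) √t / √ℓ ≤ c √t / √(log(1/t))`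
  have hA : 24 * CS * κ * Real.sqrt t ≤ 48 * CS * (Real.sqrt t / Real.sqrt ℓ) := by
    have hκle : κ ≤ 2 / Real.sqrt ℓ := by rw [le_div_iff₀ hsqℓ]; exact hκℓ
    calc 24 * CS * κ * Real.sqrt t ≤ 24 * CS * (2 / Real.sqrt ℓ) * Real.sqrt t := by gcongr
      _ = 48 * CS * (Real.sqrt t / Real.sqrt ℓ) := by ring
  have hB : 8 * CS * CD * t ≤ Real.sqrt 2 * (8 * CS * CD) * (Real.sqrt t / Real.sqrt ℓ) := by
    have htle : t ≤ Real.sqrt 2 * Real.sqrt t / Real.sqrt ℓ := by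
      rw [le_div_iff₀ hsqℓ]; exact htℓ
    calc 8 * CS * CD * t ≤ 8 * CS * CD * (Real.sqrt 2 * Real.sqrt t / Real.sqrt ℓ) :=
          mul_le_mul_of_nonneg_left htle (by positivity)
      _ = Real.sqrt 2 * (8 * CS * CD) * (Real.sqrt t / Real.sqrt ℓ) := by ring
  have hC : 8 * CF * Real.sqrt t / Real.sqrt ℓ = 8 * CF * (Real.sqrt t / Real.sqrt ℓ) := by ring
  have hsum : ‖wt x‖ ≤ (48 * CS + Real.sqrt 2 * (8 * CS * CD) + 8 * CF) * (Real.sqrt t / Real.sqrt ℓ) := by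
    refine hwt_int.trans ?_
    rw [hC]
    have hsum' := add_le_add (add_le_add hA hB) (le_refl (8 * CF * (Real.sqrt t / Real.sqrt ℓ)))
    refine hsum'.trans (le_of_eq ?_)
    ring
  have hratio : Real.sqrt t / Real.sqrt ℓ ≤ 2 * (Real.sqrt t / Real.sqrt (Real.log (1 / t))) := by
    calc Real.sqrt t / Real.sqrt ℓ = Real.sqrt t * (1 / Real.sqrt ℓ) := by ring
      _ ≤ Real.sqrt t * (2 / Real.sqrt (Real.log (1 / t))) := mul_le_mul_of_nonneg_left hinvℓ hsqt.le
      _ = 2 * (Real.sqrt t / Real.sqrt (Real.log (1 / t))) := by ring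
  have hwt_show : wt x = oseenDuhamel 1 (t ^ 2) u u t x := by rw [hwt, hs₀_def]
  rw [← hwt_show]
  calc ‖wt x‖ ≤ (48 * CS + Real.sqrt 2 * (8 * CS * CD) + 8 * CF) * (Real.sqrt t / Real.sqrt ℓ) := hsum
    _ ≤ (48 * CS + Real.sqrt 2 * (8 * CS * CD) + 8 * CF) * (2 * (Real.sqrt t / Real.sqrt (Real.log (1 / t)))) :=
        mul_le_mul_of_nonneg_left hratio (by positivity)
    _ = c * Real.sqrt t / Real.sqrt (Real.log (1 / t)) := by rw [hc_def]; ring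

end Summit.NavierStokesRegularity.NavierStokesRegularity.Theorems

end
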